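import Summits.HodgeConjecture.HodgeConjecture.Theses.BoundaryReadout
import Literature.AlgebraicGeometry.HodgeTheory.HodgeLocus
import Literature.AlgebraicGeometry.HodgeTheory.WeilClasses

/-! # Sketch — crux-strategist signatures for `HCOverNumberFields` (stmt-HodgeConjecture-1070)

First lemmas named in `STRATEGY-CENSUS.md`, stated over EXISTING declarations only (no proofs; `def … : Prop`).
-/

set_option linter.dupNamespace false

noncomputable section

namespace Summit.HodgeConjecture.HodgeConjecture.Cruxes.HCOverNumberFields.Strategist

open CategoryTheory
open Literature.AlgebraicGeometry.Motives Literature.AlgebraicGeometry.HodgeTheory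

/-- The arithmetic hypothesis of the crux (verbatim). -/
def IsDefinableOverNumberField (X : SchemeOver ℂ) : Prop :=
  ∃ (K : Type) (_ : Field K) (_ : NumberField K) (σ : K →+* ℂ) (X₀ : SchemeOver K),
    Nonempty (X ≅ (baseChangeHom σ).obj X₀)

/-- FIRST LEMMA of the Hodge-locus technique for child C₂ (Voisin 2007 Lemma 2.4 / Thm 1.5 consequence;
Charles–Schnell Thm 11.3.17 ⇒): for a smooth projective family defined over a number field `K` and a fibre
class `x = (t, α)` in the locus of Hodge classes, if `α` is WEAKLY ABSOLUTE then the base of the component of the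
locus of Hodge classes through `x` (the Hodge locus of `α`) is defined over `ℚ̄`.  Theorem in print; its
CONTRAPOSITIVE is the kill-test generator of census §N3. -/
def FirstLemmaC2_weaklyAbsolute_base_qbar : Prop :=
  ∀ (K : Type) [Field K] [NumberField K] (σ : K →+* ℂ) (𝒳₀ S₀ : SchemeOver K) (f₀ : 𝒳₀ ⟶ S₀) (n p : ℕ),
    IsSmoothProjectiveFamily ((baseChangeHom σ).map f₀) n →
      ∀ (x : FiberClass ((baseChangeHom σ).map f₀) (2 * p))
        (hx : x ∈ locusOfHodgeClasses ((baseChangeHom σ).map f₀) n p),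
        IsWeaklyAbsoluteHodgeClass n (fiberOver ((baseChangeHom σ).map f₀) x.pt) p x.cls →
          (HodgeLocusComponent.of x hx).IsBaseDefinedOverQbar

/-- The OPEN converse at ARITHMETIC points, in Hodge-locus language (Charles–Schnell p. 489: on a `ℚ̄`-variety the
component through `α` is `ℚ̄`-defined iff `α` is `ℚ̄`-de Rham; KOU 2023 Cor. 1.14 reduces fields of definition of
special subvarieties to special POINTS): at a complex point `t` fixed by `Aut(ℂ/ℚ̄)` (a `ℚ̄`-point of the base), a
rational `(p,p)` class whose Hodge-locus component has `ℚ̄`-defined base is weakly absolute.  This is the sharpest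
typed special case of child C₂ (it is C₂ for classes RIGID in the family when the base component is the point itself). -/
def OpenC2_at_arithmetic_points : Prop :=
  ∀ (K : Type) [Field K] [NumberField K] (σ : K →+* ℂ) (𝒳₀ S₀ : SchemeOver K) (f₀ : 𝒳₀ ⟶ S₀) (n p : ℕ),
    IsSmoothProjectiveFamily ((baseChangeHom σ).map f₀) n →
      ∀ (x : FiberClass ((baseChangeHom σ).map f₀) (2 * p))
        (hx : x ∈ locusOfHodgeClasses ((baseChangeHom σ).map f₀) n p),
        (∀ τ : ringAutOver σ, (∀ z ∈ (algebraicClosure ℚ ℂ).toSubfield, τ z = z) → conjPoint σ S₀ τ x.pt = x.pt) →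
          (HodgeLocusComponent.of x hx).IsBaseDefinedOverQbar →
            IsWeaklyAbsoluteHodgeClass n (fiberOver ((baseChangeHom σ).map f₀) x.pt) p x.cls

/-- The KERNEL of child C₃ as an existing item: `HeckeOrbitCompactness.WeilClassesAlgebraic` (stmt-HodgeConjecture-2522)
— algebraicity of Weil classes on abelian `2n`-folds with `φ² = -d` (all `n ≥ 2`, all `d`).  Since Weil-type CM abelian
varieties are definable over number fields and Weil classes are absolute Hodge (Deligne 1982 Thm 2.11, in print), C₃
contains this statement; conversely (André 1992 + Deligne) it gives HC for all CM abelian varieties.  Restated here on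
the real carriers in the consumers' literal shape (verbatim the item's statement). -/
def KernelW_WeilClassesAlgebraic : Prop :=
  ∀ (n : ℕ), 2 ≤ n → ∀ (d : ℕ), 0 < d → ∀ (A : AbelianVariety ℂ) (φ : A ⟶ A), A.dim = 2 * n →
    IsSmoothProjective (2 * n) A.X → φ ≫ φ = -(d • 𝟙 A) →
      ∀ c : complexBetti A.X (2 * n), IsRationalClass c → IsOfHodgeType (2 * n) A.X (2 * n) n n c →
        (∃ c₁ c₂ : complexBetti A.X (2 * n), c = c₁ + c₂ ∧
          (∀ x y : ℕ, Literature.AlgebraicTopology.SingularHomology.singularCohomology.map ℂ ℂ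
              (AlgPoints.mapContinuous (L := ℂ) (x • 𝟙 A + y • φ).hom.hom.hom) (2 * n) c₁ =
            ((x : ℂ) + (y : ℂ) * Complex.I * (Real.sqrt d : ℂ)) ^ (2 * n) • c₁) ∧
          (∀ x y : ℕ, Literature.AlgebraicTopology.SingularHomology.singularCohomology.map ℂ ℂ
              (AlgPoints.mapContinuous (L := ℂ) (x • 𝟙 A + y • φ).hom.hom.hom) (2 * n) c₂ =
            ((x : ℂ) - (y : ℂ) * Complex.I * (Real.sqrt d : ℂ)) ^ (2 * n) • c₂)) →
        c ∈ algebraicClasses A.X n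

/-- C₃ restricted to the kernel: absolute Hodge Weil classes on ARITHMETIC abelian `2n`-folds are algebraic — the
first target of any lead on child C₃ (equivalent to `KernelW_WeilClassesAlgebraic` for CM members granted "Weil classes
are absolute Hodge", Deligne 1982). -/
def FirstTargetC3_arithmeticWeil : Prop :=
  ∀ (n : ℕ), 2 ≤ n → ∀ (d : ℕ), 0 < d → ∀ (A : AbelianVariety ℂ) (φ : A ⟶ A), A.dim = 2 * n →
    IsSmoothProjective (2 * n) A.X → IsDefinableOverNumberField A.X → φ ≫ φ = -(d • 𝟙 A) →
      ∀ c ∈ weilClassesOf A φ n d, IsAbsoluteHodgeClass (2 * n) A.X n c → c ∈ algebraicClasses A.X n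

/-- Sanity: child C₃ (statement inlined) implies the first target outright. -/
theorem firstTargetC3_of_child3
    (h₃ : ∀ ⦃n : ℕ⦄ ⦃X : SchemeOver ℂ⦄, IsSmoothProjective n X → IsDefinableOverNumberField X →
      ∀ (p : ℕ) (c : complexBetti X (2 * p)), IsAbsoluteHodgeClass n X p c → c ∈ algebraicClasses X p) :
    FirstTargetC3_arithmeticWeil :=
  fun n _ d _ A _φ _ hA hK _ c _ hc => h₃ hA hK n c hc

end Summit.HodgeConjecture.HodgeConjecture.Cruxes.HCOverNumberFields.Strategist

end
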